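import Mathlib
import Summits.Ventures.PercRepro.TriangleCapFourRowThreeSecondBest
import Summits.Ventures.PercRepro.TriangleCapFourRowFourTMain

/-!
# PercRepro — THE GAP OF THE ONE-TRIANGLE FAMILY AS A FUNCTION OF THE CELL, AND THE NON-BIPARTITE SECOND-BEST
TABLE ON THE ROW `a = 4` AT `r = 3, 4` IN ONE STATEMENT (p3, gen 46; part 199aa)

`tFamilyGap k a r = 2 (k − 1 − 2a) + 2 (r + 2 − a) (r + 1 − a)` is the gap of `tFamilyGen (k − 1) a (r − a + 2)` on the
cell `(k, a, r)` (part 197: `2 (n − 2a) + 2 r₀ (r₀ − 1)` with `n = k − 1`, `r₀ = r − a + 2`). It agrees with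
`nonbipGap` at `r = a − 1` on the row `a = 4` (`tFamilyGap k 4 3 = 2 (k − 9)`) and differs from its fallback branch
at `r = 4` (`tFamilyGap k 4 4 = 2k − 14 = 2 (k − 9) + 4`): the def `nonbipGap` must not be used beyond `r = a − 1`.
`nonbip_second_best_row_four_T (r = 3 ∨ r = 4) (12 ≤ k)`: every non-`4`-bipartite `K₄⁻`-free graph on `Fin k` with
`4 (k − 4) − r` edges has `Σ_v d(v)² + r (k − 1 − r) + tFamilyGap k 4 r ≤ m k`, and the value is attained by a
non-`4`-bipartite graph (parts 199e and 199z). Axioms: standard.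
-/

namespace PercRepro

namespace TriangleCap

namespace C047

open Finset

/-- The gap of the one-triangle family `tFamilyGen (k − 1) a (r − a + 2)` on the cell `(k, a, r)`, `a − 2 ≤ r`:
`2 (k − 1 − 2a) + 2 (r + 2 − a) (r + 1 − a)` (the truncated subtractions keep the formula in `ℕ`). -/
def tFamilyGap (k a r : ℕ) : ℕ := 2 * (k - 1 - 2 * a) + 2 * ((r + 2 - a) * (r + 1 - a))

/-- On `(k, 4, 3)` the family gap is `2 (k − 9)` — the value `nonbipGap k 4 3` of part 199e. -/
theorem tFamilyGap_four_three (k : ℕ) : tFamilyGap k 4 3 = 2 * (k - 9) := by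
  unfold tFamilyGap
  have e : (3 + 2 - 4) * (3 + 1 - 4) = 0 := by norm_num
  omega

/-- On `(k, 4, 4)` the family gap is `2k − 14 = 2 (k − 9) + 4` (`9 ≤ k`) — NOT the fallback value `2 (k − 9)` of the
def `nonbipGap`. -/
theorem tFamilyGap_four_four (k : ℕ) (hk : 9 ≤ k) : tFamilyGap k 4 4 = 2 * k - 14 := by
  unfold tFamilyGap
  have e : (4 + 2 - 4) * (4 + 1 - 4) = 2 := by norm_num
  omega

/-- **THE NON-BIPARTITE SECOND-BEST TABLE ON THE ROW `a = 4` AT `r = 3, 4`:** for `12 ≤ k` and `r ∈ {3, 4}`, every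
non-`4`-bipartite `K₄⁻`-free graph on `Fin k` with `4 (k − 4) − r` edges has
`Σ_v d(v)² + r (k − 1 − r) + tFamilyGap k 4 r ≤ m k`, and the value is attained by a non-`4`-bipartite graph. -/
theorem nonbip_second_best_row_four_T (k r : ℕ) (hr : r = 3 ∨ r = 4) (hk : 12 ≤ k) :
    (∀ (D : SimpleGraph (Fin k)) [DecidableRel D.Adj], K4mFree D → D.edgeFinset.card + r = 4 * (k - 4) →
        (¬ ∃ A : Finset (Fin k), A.card = 4 ∧ BipSub D A) →
        ∑ v, deg D v * deg D v + r * (k - 1 - r) + tFamilyGap k 4 r ≤ D.edgeFinset.card * k) ∧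
      ∃ (D : SimpleGraph (Fin k)) (_ : DecidableRel D.Adj), K4mFree D ∧ D.edgeFinset.card + r = 4 * (k - 4) ∧
        (¬ ∃ A : Finset (Fin k), A.card = 4 ∧ BipSub D A) ∧
        ∑ v, deg D v * deg D v + r * (k - 1 - r) + tFamilyGap k 4 r = D.edgeFinset.card * k := by
  rcases hr with rfl | rfl
  · rw [tFamilyGap_four_three]
    have e : 3 * (k - 1 - 3) = 3 * (k - 4) := by omega
    have e2 : 2 * (k - 9) = 2 * k - 18 := by omega
    rw [e, e2]
    exact four_three_nonbip_second_best k (by omega)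
  · rw [tFamilyGap_four_four k (by omega)]
    have e : 4 * (k - 1 - 4) = 4 * (k - 5) := by omega
    rw [e]
    obtain ⟨h1, D, inst, hK, hE, hnb, hS⟩ := four_four_nonbip_second_best k hk
    exact ⟨h1, D, inst, hK, hE, fun ⟨A, _, hA⟩ => hnb A hA, hS⟩

end C047

end TriangleCap

end PercRepro
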